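import Summits.HodgeConjecture.HodgeConjecture.Theorems.F0P2pWeylConstituentsRankOne         -- ★ p828796 (F3b): `isConstituentOf_of_weylData`
import Summits.HodgeConjecture.HodgeConjecture.Theorems.F0P2pCmPrincipalSeriesInterface      -- ★ p829948 (F4b): the interface at `cmPrincipalSeries`
import Literature.NumberTheory.Automorphic.UnitaryGroupUnipotentLimitCompactOpen               -- ★ p827152 (F1): `isLimitOfCompactOpen_cmBorelTriple_N`
import Literature.NumberTheory.Automorphic.JacquetNonzeroEmbedsNormalizedInd                 -- ★ `UnitaryGroup.torusU_mul_comm`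
import Literature.NumberTheory.Automorphic.U3PrincipalSeriesJacquetFiltrationFullUnfold      -- ★ p831282: N1 as a theorem-world `Iff`
import Literature.NumberTheory.Automorphic.U3JacquetVanishingSupercuspidal                   -- ★ p831380: N6 `_holds`
import Literature.NumberTheory.Rogawski1990.U3PrincipalSeriesWeylConjugateUnfold             -- ★ p831364: the K1w letter as a theorem-world `Iff`
import HarnessLib

/-!
# Crux `H413`: the K1w letter `JH(i_G(χ)) = JH(i_G(wχ))` for `U(Φ₃)(L⁺_v)` FROM N1 (file 4c of the K1w pay-down)

Cell hodgecm-mathlib (D-0151), FLOOR 0, crux item H413 = stmt-HodgeConjecture-24833; pay-down line `Cruxes/H413/Lines/F0_P2GR91NJacquet.lean`,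
K1 sub-line `Lines/F0_P2GR91NJacquetK1.lean`: `stub_K1w := F0P2oK1wOfWeylConj.stubK1w_of_weylConj stub_K1w_letter` with
`stub_K1w_letter : Rogawski1990.cmPrincipalSeries_isConstituentOf_weylConj` (★ p826332, the booked letter K1w = #98).  THIS FILE proves that
letter from the ONE booked letter N1 ★ `UnitaryGroup.U3PrincipalSeriesJacquetFiltration` ([Casselman1995, L. 7.1.1 (a)]) — the other input of
Casselman's rank-one bookkeeping, N6 ★ `Rogawski1990.u3_isSupercuspidal_iff_jacquet_eq_zero`, is a THEOREM now (★ `…_holds`, p831380) — via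
files 1–4b (★ `F0P2pJacquetConstituentLemmas`, ★ `F0P2pEigenlineFunctionals`, ★ `F0P2pWeylConstituentsRankOne`, ★ `F0P2pTorusPairsAndVacuity`,
★ `F0P2pCmPrincipalSeriesInterface`) and the two theorem-world bridges ★ `U3PrincipalSeriesJacquetFiltration_iff` (N1) and ★
`cmPrincipalSeries_isConstituentOf_weylConj_iff` (K1w): both letters are `def … : Prop`, whose bodies carry Lean's abstracted instance proofs
`_proof_k` in ≈ 2·10⁷ positions of the Jacquet-module type, so they are met ONLY through those bridges (syntactic unification; see their
docstrings — meeting the defs directly costs the elaborator > 8·10⁶ heartbeats although the kernel agrees in < 1 s).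
HEAD: `cmPrincipalSeries_isConstituentOf_weylConj_of_N1 (hN1 : ∀ L …, U3PrincipalSeriesJacquetFiltration L) : cmPrincipalSeries_isConstituentOf_weylConj`;
the fold is `stub_K1w_letter := …of_N1 stub_N1_letter` (desk's edition).  Books: K1w (#98) becomes CLOSED-derived from N1.
HC_CM is proved only modulo the 2 remaining named inputs (hLiu418, h413) until rung 0 closes; nothing here proves HC_CM.

CONTENT.  §1 one inclusion `JH(i_G(wχ)) ⊆ JH(i_G(χ))` for CONTINUOUS `χ₁, χ₂` at a non-split `v`: if `χ = wχ` nothing to do; otherwise N1 at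
`(χ₁, χ₂)` and at `(χ̄₁⁻¹, χ₂)` (with `w² = 1`, ★ `conjInvChar_conjInvChar`, on the line character of the second) are the two Jacquet filtrations,
★ F4b supplies Frobenius ∕ uniqueness ∕ evaluation ∕ no-zero-Jacquet-constituent (the last from N6 `_holds`), `T` is commutative (★), `N` is a
limit of compact open subgroups (★ F1), and ★ `isConstituentOf_of_weylData` concludes.  §2 the same inclusion for ALL `χ₁, χ₂`: a discontinuous
pair has `i_G(wχ) = 0` (★ `subsingleton_cmPrincipalSeries_of_not_continuous`; `wχ` is discontinuous as soon as `χ` is, ★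
`continuous_components_of_continuous_torusCharPair`), which has no constituent.  §3 the letter: both inclusions (the second at `(χ̄₁⁻¹, χ₂)`,
`w² = 1`), transported through ★ `cmPrincipalSeries_isConstituentOf_weylConj_iff`.

## References
* [Rogawski1990] §12.1 p. 171, §12.2 pp. 173–174.  * [Casselman1995] §7.1 (L. 7.1.1, Cor. 7.1.2), Thm. 5.3.1, Thm. 6.3.5.
* [BernsteinZelevinsky1977] §2.12, Thm. 2.9.
-/

set_option autoImplicit false
-- the mandated namespace has the single-problem summit's repeated segment (`HodgeConjecture.HodgeConjecture`)
set_option linter.dupNamespace false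

noncomputable section

open NumberField IsDedekindDomain MeasureTheory
open scoped Matrix

open Literature.NumberTheory Literature.NumberTheory.Automorphic Literature.NumberTheory.Automorphic.UnitaryGroup
open Literature.NumberTheory.Rogawski1990
open Literature.RepresentationTheory.FiniteGroups Literature.RepresentationTheory.Semisimple

namespace Summit.HodgeConjecture.HodgeConjecture.Cruxes.H413.F0P2pK1wLetterOfN1

open F0P2pTorusPairsAndVacuity F0P2pCmPrincipalSeriesInterface

section CM

variable (L : Type) [Field L] [NumberField L] [IsCMField L] (v : HeightOneSpectrum (𝓞 ↥(maximalRealSubfield L)))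

/-! ## §1 One inclusion, continuous characters -/

set_option synthInstance.maxHeartbeats 400000 in
set_option maxHeartbeats 8000000 in
/-- **ONE INCLUSION, CONTINUOUS CASE: `JH(i_G(wχ)) ⊆ JH(i_G(χ))`** for continuous `χ₁, χ₂` at a non-split `v` (`wχ = (χ̄₁⁻¹, χ₂)` spelled ★
`cmTorusCharPair L v (conjInvChar σ χ₁) χ₂`) — if `χ = wχ` there is nothing to do; otherwise N1 (through its theorem-world bridge ★
`U3PrincipalSeriesJacquetFiltration_iff`) at `(χ₁, χ₂)` and at `(χ̄₁⁻¹, χ₂)` — with `w² = 1` on the line character of the second — supplies the two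
Jacquet filtrations, ★ F4b the Frobenius ∕ uniqueness ∕ evaluation ∕ no-zero-Jacquet inputs (the last from N6 ★ `…_holds`), `T` is commutative (★),
`N` a limit of compact open subgroups (★ F1), and ★ `isConstituentOf_of_weylData` concludes.
[cite: Rogawski1990, §12.2 p. 174] [cite: Casselman1995, §7.1 Cor. 7.1.2] -/
theorem isConstituentOf_weylConj_imp_of_continuous
    (hN1 : ∀ (L : Type) [Field L] [NumberField L] [IsCMField L], UnitaryGroup.U3PrincipalSeriesJacquetFiltration L)
    (hns : ∀ w : PlacesOver L v, IsCMField.complexConj L • w.1 = w.1)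
    (χ₁ : (LocalRing L v)ˣ →* ℂˣ) (χ₂ : ↥(normOneUnits (conjLocal L (IsCMField.complexConj L) v)) →* ℂˣ)
    (h₁ : Continuous fun x => ((χ₁ x : ℂˣ) : ℂ)) (h₂ : Continuous fun x => ((χ₂ x : ℂˣ) : ℂ))
    (c : IrrClass (Gqs L v))
    (hc : c.IsConstituentOf (cmPrincipalSeries L 3 v
      (cmTorusCharPair L v (conjInvChar (conjLocal L (IsCMField.complexConj L) v) χ₁) χ₂))) :
    c.IsConstituentOf (cmPrincipalSeries L 3 v (cmTorusCharPair L v χ₁ χ₂)) := by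
  haveI := locallyCompactSpace_cmBorelU L 3 v
  by_cases heq : cmTorusCharPair L v χ₁ χ₂ = cmTorusCharPair L v (conjInvChar (conjLocal L (IsCMField.complexConj L) v) χ₁) χ₂
  · rw [heq]; exact hc
  have hww : cmWeylTorusCharPair L v (conjInvChar (conjLocal L (IsCMField.complexConj L) v) χ₁) χ₂ = cmTorusCharPair L v χ₁ χ₂ := by
    rw [cmWeylTorusCharPair_eq, conjInvChar_conjInvChar _ (conjLocal_conjLocal_cm L v)]
  have h₁' : Continuous fun x => ((conjInvChar (conjLocal L (IsCMField.complexConj L) v) χ₁ x : ℂˣ) : ℂ) :=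
    continuous_coe_conjInvChar _ (continuous_conjLocal L (IsCMField.complexConj L) v) χ₁ h₁
  -- the two filtrations: N1 through its theorem-world bridge; both line characters respelled `cmTorusCharPair … (conjInvChar …)`
  -- (`cmWeylTorusCharPair_eq` is `rfl`; `w² = 1` on the second), so that every binder of ★ `isConstituentOf_of_weylData` is met syntactically
  obtain ⟨hfd, hX2, ℓ, hℓ1, hline, hquot⟩ := (UnitaryGroup.U3PrincipalSeriesJacquetFiltration_iff L).1 (hN1 L) v hns χ₁ χ₂ h₁ h₂
  obtain ⟨hfd', hX2', ℓ', hℓ'1, hline', hquot'⟩ := (UnitaryGroup.U3PrincipalSeriesJacquetFiltration_iff L).1 (hN1 L) v hns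
    (conjInvChar (conjLocal L (IsCMField.complexConj L) v) χ₁) χ₂ h₁' h₂
  have hline₁ := fun m x hx => (hline m x hx).trans (by rw [cmWeylTorusCharPair_eq])
  have hline₂ := fun m x hx => (hline' m x hx).trans (by rw [hww])
  exact F0P2pWeylConstituentsRankOne.isConstituentOf_of_weylData (cmBorelTriple L 3 v) (isLimitOfCompactOpen_cmBorelTriple_N L 3 v)
    (UnitaryGroup.torusU_mul_comm _ _) (cmTorusCharPair L v χ₁ χ₂)
    (cmTorusCharPair L v (conjInvChar (conjLocal L (IsCMField.complexConj L) v) χ₁) χ₂) heq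
    (cmPrincipalSeries L 3 v (cmTorusCharPair L v χ₁ χ₂))
    (cmPrincipalSeries L 3 v (cmTorusCharPair L v (conjInvChar (conjLocal L (IsCMField.complexConj L) v) χ₁) χ₂))
    (isSmooth_cmPrincipalSeries L v _)
    (fun φ hφ => exists_intertwiningMap_cmPrincipalSeries_ne_zero L v _ _ (isSmooth_cmPrincipalSeries L v _) φ hφ)
    (fun φ hφ => exists_intertwiningMap_cmPrincipalSeries_ne_zero L v _ _ (isSmooth_cmPrincipalSeries L v _) φ hφ)
    (intertwiningMap_cmPrincipalSeries_eq_smul L v _ _ (isSmooth_cmPrincipalSeries L v _))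
    (intertwiningMap_cmPrincipalSeries_eq_smul L v _ _ (isSmooth_cmPrincipalSeries L v _))
    (exists_mem_mk_ne_zero_of_ne_bot L v _) (exists_mem_mk_ne_zero_of_ne_bot L v _)
    ⟨hfd, hX2, ℓ, hℓ1, hline₁, hquot⟩ ⟨hfd', hX2', ℓ', hℓ'1, hline₂, hquot'⟩
    (fun r hr h0 => not_subsingleton_coinvariants_of_isConstituentOf_cmPrincipalSeries L v
      u3_isSupercuspidal_iff_jacquet_eq_zero_holds hns _ r hr h0) hc

/-! ## §2 One inclusion, all characters -/

set_option synthInstance.maxHeartbeats 400000 in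
set_option maxHeartbeats 8000000 in
/-- **ONE INCLUSION: `JH(i_G(wχ)) ⊆ JH(i_G(χ))`** at a non-split `v`, for ALL `χ₁, χ₂` (no continuity binder): the continuous case is §1;
otherwise `i_G(wχ) = 0` (the pair `wχ = (χ̄₁⁻¹, χ₂)` is discontinuous as soon as `χ₁` or `χ₂` is — ★ `continuous_components_of_continuous_torusCharPair`,
`w² = 1` — and ★ `subsingleton_cmPrincipalSeries_of_not_continuous`) and the zero representation has no constituent.
[cite: Rogawski1990, §12.2 p. 174] -/
theorem isConstituentOf_weylConj_imp
    (hN1 : ∀ (L : Type) [Field L] [NumberField L] [IsCMField L], UnitaryGroup.U3PrincipalSeriesJacquetFiltration L)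
    (hns : ∀ w : PlacesOver L v, IsCMField.complexConj L • w.1 = w.1)
    (χ₁ : (LocalRing L v)ˣ →* ℂˣ) (χ₂ : ↥(normOneUnits (conjLocal L (IsCMField.complexConj L) v)) →* ℂˣ)
    (c : IrrClass (Gqs L v))
    (hc : c.IsConstituentOf (cmPrincipalSeries L 3 v
      (cmTorusCharPair L v (conjInvChar (conjLocal L (IsCMField.complexConj L) v) χ₁) χ₂))) :
    c.IsConstituentOf (cmPrincipalSeries L 3 v (cmTorusCharPair L v χ₁ χ₂)) := by
  by_cases hcont : Continuous (fun x => ((χ₁ x : ℂˣ) : ℂ)) ∧ Continuous (fun x => ((χ₂ x : ℂˣ) : ℂ))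
  · exact isConstituentOf_weylConj_imp_of_continuous L v hN1 hns χ₁ χ₂ hcont.1 hcont.2 c hc
  · exfalso
    have hw : ¬ Continuous fun t : ↥(torusU (conjLocal L (IsCMField.complexConj L) v) (cmLocalForm L 3 v)) =>
        ((cmTorusCharPair L v (conjInvChar (conjLocal L (IsCMField.complexConj L) v) χ₁) χ₂ t : ℂˣ) : ℂ) := by
      intro h
      obtain ⟨h₁', h₂⟩ := continuous_components_of_continuous_torusCharPair (conjLocal L (IsCMField.complexConj L) v)
        (continuous_conjLocal L (IsCMField.complexConj L) v) (conjLocal_conjLocal_cm L v) (cmLocalForm L 3 v)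
        (cmLocalForm_eq_over L 3 v) (conjInvChar (conjLocal L (IsCMField.complexConj L) v) χ₁) χ₂ h
      refine hcont ⟨?_, h₂⟩
      have h₁ := continuous_coe_conjInvChar _ (continuous_conjLocal L (IsCMField.complexConj L) v) _ h₁'
      rwa [conjInvChar_conjInvChar _ (conjLocal_conjLocal_cm L v)] at h₁
    haveI := locallyCompactSpace_cmBorelU L 3 v
    haveI := subsingleton_cmPrincipalSeries_of_not_continuous L v _ hw
    exact IrrClass.not_isConstituentOf_of_subsingleton (cmPrincipalSeries L 3 v
      (cmTorusCharPair L v (conjInvChar (conjLocal L (IsCMField.complexConj L) v) χ₁) χ₂)) c hc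

/-- **BOTH INCLUSIONS: `JH(i_G(χ)) = JH(i_G(wχ))`** at a non-split `v`, for all `χ₁, χ₂` and every class `c` — §2 at `(χ₁, χ₂)` and at
`(χ̄₁⁻¹, χ₂)` (`w² = 1`, ★ `conjInvChar_conjInvChar`).  Theorem-world statement (spelling ★ `cmTorusCharPair` ∕ ★ `conjInvChar`); §3 transports it
to the letter. [cite: Rogawski1990, §12.2 p. 174] [cite: BernsteinZelevinsky1977, Thm. 2.9] -/
theorem isConstituentOf_weylConj_iff_of_N1
    (hN1 : ∀ (L : Type) [Field L] [NumberField L] [IsCMField L], UnitaryGroup.U3PrincipalSeriesJacquetFiltration L)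
    (hns : ∀ w : PlacesOver L v, IsCMField.complexConj L • w.1 = w.1)
    (χ₁ : (LocalRing L v)ˣ →* ℂˣ) (χ₂ : ↥(normOneUnits (conjLocal L (IsCMField.complexConj L) v)) →* ℂˣ)
    (c : IrrClass (Gqs L v)) :
    c.IsConstituentOf (cmPrincipalSeries L 3 v (cmTorusCharPair L v χ₁ χ₂)) ↔
      c.IsConstituentOf (cmPrincipalSeries L 3 v
        (cmTorusCharPair L v (conjInvChar (conjLocal L (IsCMField.complexConj L) v) χ₁) χ₂)) := by
  constructor
  · intro h
    have h' := isConstituentOf_weylConj_imp L v hN1 hns (conjInvChar (conjLocal L (IsCMField.complexConj L) v) χ₁) χ₂ c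
    rw [conjInvChar_conjInvChar _ (conjLocal_conjLocal_cm L v)] at h'
    exact h' h
  · exact isConstituentOf_weylConj_imp L v hN1 hns χ₁ χ₂ c

end CM

/-! ## §3 The letter -/

/-- **THE K1w LETTER FROM N1: `JH(i_G(χ)) = JH(i_G(wχ))`, `w(χ₁, χ₂) = (χ̄₁⁻¹, χ₂)`, for the quasi-split `U(3)(L⁺_v)` at a NON-SPLIT place**
— ★ `Rogawski1990.cmPrincipalSeries_isConstituentOf_weylConj` («`i_G(χ)` and `i_G(wχ)` have the same sets of constituents» [Rogawski1990, §12.2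
p. 174]; [BernsteinZelevinsky1977, Thm. 2.9]) proved from the booked letter N1 ★ `UnitaryGroup.U3PrincipalSeriesJacquetFiltration`
([Casselman1995, L. 7.1.1 (a)]) by Casselman's rank-one bookkeeping (N6 [Casselman1995, Thm. 5.3.1] being the theorem ★ `…_holds`): the
theorem-world statement `isConstituentOf_weylConj_iff_of_N1` transported through the bridge ★ `cmPrincipalSeries_isConstituentOf_weylConj_iff`
(★ `cmTorusCharPair` and ★ `conjInvChar` unfold to the letter's spelling by `rfl`).  Closes `stub_K1w_letter` of the K1 sub-line by
`…_of_N1 stub_N1_letter`. [cite: Rogawski1990, §12.2 p. 174] [cite: BernsteinZelevinsky1977, Thm. 2.9] [cite: Casselman1995, §7.1 Cor. 7.1.2] -/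
theorem cmPrincipalSeries_isConstituentOf_weylConj_of_N1
    (hN1 : ∀ (L : Type) [Field L] [NumberField L] [IsCMField L], UnitaryGroup.U3PrincipalSeriesJacquetFiltration L) :
    cmPrincipalSeries_isConstituentOf_weylConj :=
  cmPrincipalSeries_isConstituentOf_weylConj_iff.2 fun L _ _ _ v hns χ₁ χ₂ c =>
    isConstituentOf_weylConj_iff_of_N1 L v hN1 hns χ₁ χ₂ c

end Summit.HodgeConjecture.HodgeConjecture.Cruxes.H413.F0P2pK1wLetterOfN1

end
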